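import Mathlib
import Literature.NumberTheory.Sieve.BombieriVinogradovReduction
import Literature.NumberTheory.Sieve.VaughanMeanValue

/-!
# High-conductor reduction for the excised discrepancy (crux `EH`, stmt-Parity-11314)

Line `upward-replication-free-factorability`.  The conductor-excised discrepancy of the primes to
modulus `q` with cut `D`,
`Δ♯_D(x; q, a) = φ(q)⁻¹ ∑_{χ mod q, cond χ > D} χ(a⁻¹) ψ(x, χ)`, and its maximum over reduced classes
`E♯_D(x; q) = max_{a} ‖Δ♯_D(x; q, a)‖`, are controlled ON AVERAGE over `q ≤ Q` by the primitive
characters of conductor in `(D, Q]` — the mirror image of the landed low-conductor reduction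
`LowConductorAux.stub_lowConductor_reduction` (there: conductors `≤ D`; here: conductors `> D`),
with the same bookkeeping (Davenport, *Multiplicative Number Theory*, ch. 28; Cojocaru–Murty, §9.2;
tree file `Literature/NumberTheory/Sieve/BombieriVinogradovReduction.lean`):

* `norm_excised_le` — `‖Δ♯_D(x; q, a)‖ ≤ φ(q)⁻¹ ∑_{cond χ > D} ‖ψ'(x, χ)‖` (`|χ(a⁻¹)| ≤ 1`; for
  `D ≥ 1` these `χ` are non-principal, so `ψ' = ψ`);
* `sum_highCond_le` — reindex the characters of conductor `> D` by `(d, χ₁)`, `d ∣ q`, `D < d`,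
  `χ₁` primitive mod `d`, and pass to the inducing character;
* `sum_excised_le` — summing over `q ≤ Q` and swapping the `q`- and `d`-sums:
  `∑_{q ≤ Q} E♯_D(x; q) ≤ W(Q) ∑_{D < d ≤ Q} Φ(x; d) + ⌊log x/log 2⌋ Q log Q W(Q)`
  (`W = totientInvSum`, `Φ = primTerm`);
* `sum_excised_le_vaughan` — inserting the tree's Abel-summed form of Vaughan's mean value theorem
  (`sum_Ioc_primTerm_le`, with `VaughanBound C₁`; unconditional via `vaughan_meanValue_holds`):
  `∑_{q ≤ Q} E♯_D(x; q) ≤ W(Q) C₁ log⁴(xQ) [x/(Q+1) + x^{5/6} + x^{1/2}Q + x/(D+1) + x^{5/6}(1+log Q)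
  + x^{1/2}Q] + ⌊log x/log 2⌋ Q log Q W(Q)`.

This is the first-moment (`k = 1`, Bombieri–Vinogradov-strength) input for the purity of `Δ♯` in
windows of moduli below `x^{1/2}` (file `LiouvilleShiftedTablesEHPurityBelowHalf.lean`).  No
definitions are introduced.  References: [DavenportMNT1980, ch. 28]; [CojocaruMurty2005, §9.2];
[Vaughan1980, Theorem 1].
-/

namespace Summit.Parity.GeneralizedHardyLittlewood.Theorems.EH.HighConductorReduction

open Finset Literature.NumberTheory.Sieve
open scoped Classical

/-- For `D ≥ 1` and `(a, q) = 1`: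
`‖φ(q)⁻¹ ∑_{cond χ > D} χ(a⁻¹) ψ(x, χ)‖ ≤ φ(q)⁻¹ ∑_{cond χ > D} ‖ψ'(x, χ)‖` — triangle inequality,
`|χ(a⁻¹)| ≤ 1`, and `ψ = ψ'` off the principal character (which has conductor `1 ≤ D`).
[cite: DavenportMNT1980, ch. 28] -/
theorem norm_excised_le (q : ℕ) [NeZero q] (a : (ZMod q)ˣ) (x : ℝ) {D : ℕ} (hD : 1 ≤ D) :
    ‖((Nat.totient q : ℂ))⁻¹ *
        ∑ χ ∈ (Finset.univ : Finset (DirichletCharacter ℂ q)) with D < χ.conductor,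
          χ (a : ZMod q)⁻¹ * chebyshevPsiChar χ x‖ ≤
      (Nat.totient q : ℝ)⁻¹ *
        ∑ χ ∈ (Finset.univ : Finset (DirichletCharacter ℂ q)) with D < χ.conductor,
          ‖psiPrime χ x‖ := by
  rw [norm_mul, norm_inv, Complex.norm_natCast]
  refine mul_le_mul_of_nonneg_left ((norm_sum_le _ _).trans (Finset.sum_le_sum fun χ hχ => ?_))
    (inv_nonneg.2 (Nat.cast_nonneg _))
  have hne : χ ≠ 1 := by
    rintro rfl
    rw [Finset.mem_filter, DirichletCharacter.conductor_one] at hχ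
    omega
  rw [norm_mul, psiPrime_of_ne_one hne]
  exact mul_le_of_le_one_left (norm_nonneg _) (χ.norm_le_one _)

/-- The characters of conductor `> D` reindexed by `(d, χ₁)` with `d ∣ q`, `D < d`, `χ₁` primitive
mod `d` (`χ = changeLevel χ₁`, `d = cond χ`), and bounded through the inducing character:
`‖ψ'(x, χ)‖ ≤ M(x; d, χ₁) + R(q, x)` (`norm_psiPrime_changeLevel_le`, `norm_psiPrime_le_majorant`);
there are at most `q` terms. [cite: CojocaruMurty2005, §9.2] -/
theorem sum_highCond_le (q : ℕ) [NeZero q] {x : ℝ} (hx : 0 ≤ x) (D : ℕ) :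
    ∑ χ ∈ (Finset.univ : Finset (DirichletCharacter ℂ q)) with D < χ.conductor, ‖psiPrime χ x‖ ≤
      ∑ d ∈ q.divisors with D < d, (∑ χ ∈ (univ : Finset (DirichletCharacter ℂ d)).filter
          DirichletCharacter.IsPrimitive, majorant x ⟨d, χ⟩) + q * nonCoprimePart q x := by
  set T : Finset (Σ d : ℕ, DirichletCharacter ℂ d) := (q.divisors.filter (D < ·)).sigma fun d =>
    (univ : Finset (DirichletCharacter ℂ d)).filter DirichletCharacter.IsPrimitive with hT
  have hTsub : T ⊆ primIndex q := fun σ hσ => by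
    rw [hT, Finset.mem_sigma, Finset.mem_filter] at hσ
    rw [primIndex, Finset.mem_sigma]
    exact ⟨hσ.1.1, hσ.2⟩
  have himage : (Finset.univ : Finset (DirichletCharacter ℂ q)).filter
      (fun χ => D < χ.conductor) ⊆ T.image (induce q) := by
    intro χ hχ
    rw [Finset.mem_filter] at hχ
    refine Finset.mem_image.2 ⟨⟨χ.conductor, χ.primitiveCharacter⟩, ?_, ?_⟩
    · rw [hT, Finset.mem_sigma, Finset.mem_filter, Finset.mem_filter, Nat.mem_divisors]
      exact ⟨⟨⟨χ.conductor_dvd_level, NeZero.ne q⟩, hχ.2⟩, Finset.mem_univ _,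
        χ.primitiveCharacter_isPrimitive⟩
    · rw [induce, dif_pos χ.conductor_dvd_level]
      exact χ.changeLevel_primitiveCharacter
  have h2 : ∀ σ ∈ T, ‖psiPrime (induce q σ) x‖ ≤ majorant x σ + nonCoprimePart q x := by
    intro σ hσ
    have hσ' := hTsub hσ
    have hdq : σ.1 ∣ q := (mem_primIndex.1 hσ').1
    rw [induce, dif_pos hdq]
    refine (norm_psiPrime_changeLevel_le hdq σ.2 x).trans ?_
    gcongr
    exact norm_psiPrime_le_majorant hσ' hx le_rfl
  calc ∑ χ ∈ (Finset.univ : Finset (DirichletCharacter ℂ q)) with D < χ.conductor, ‖psiPrime χ x‖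
      ≤ ∑ χ ∈ T.image (induce q), ‖psiPrime χ x‖ :=
        Finset.sum_le_sum_of_subset_of_nonneg himage fun _ _ _ => norm_nonneg _
    _ ≤ ∑ σ ∈ T, ‖psiPrime (induce q σ) x‖ :=
        Finset.sum_image_le_of_nonneg fun _ _ => norm_nonneg _
    _ ≤ ∑ σ ∈ T, (majorant x σ + nonCoprimePart q x) := Finset.sum_le_sum h2
    _ = ∑ σ ∈ T, majorant x σ + T.card * nonCoprimePart q x := by
        rw [Finset.sum_add_distrib, Finset.sum_const, nsmul_eq_mul]
    _ ≤ _ := by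
        rw [hT, Finset.sum_sigma]
        gcongr
        · exact nonCoprimePart_nonneg q x
        · exact_mod_cast (Finset.card_le_card hTsub).trans (card_primIndex_le q)

/-- **The high-conductor reduction.** For `Q ≥ 0`, `D ≥ 1`, `x ≥ 0`:
`∑_{q ≤ Q} max_a ‖Δ♯_D(x; q, a)‖ ≤ W(Q) ∑_{D < d ≤ Q} Φ(x; d) + ⌊log x/log 2⌋ Q log Q W(Q)`
(Steps A–C summed over `q ≤ Q` with the order of summation swapped: `sum_mul_sum_divisors_eq`,
`sum_filter_dvd_totient_inv_le`, `nonCoprimePart_le`). [cite: CojocaruMurty2005, §9.2] -/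
theorem sum_excised_le :
    ∀ (Q D : ℕ), 1 ≤ D → ∀ x : ℝ, 0 ≤ x →
      ∑ q ∈ Finset.Icc 1 Q, ⨆ a : (ZMod q)ˣ,
          ‖((Nat.totient q : ℂ))⁻¹ *
              ∑ χ ∈ (Finset.univ : Finset (DirichletCharacter ℂ q)) with D < χ.conductor,
                χ (a : ZMod q)⁻¹ * Literature.NumberTheory.Sieve.chebyshevPsiChar χ x‖ ≤
        Literature.NumberTheory.Sieve.totientInvSum Q *
            ∑ d ∈ Finset.Ioc D Q, Literature.NumberTheory.Sieve.primTerm x d +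
          ⌊Real.log x / Real.log 2⌋₊ *
            ((Q : ℝ) * Real.log Q * Literature.NumberTheory.Sieve.totientInvSum Q) := by
  intro Q D hD x hx
  set G : ℕ → ℝ := fun d => ∑ χ ∈ (univ : Finset (DirichletCharacter ℂ d)).filter
    DirichletCharacter.IsPrimitive, majorant x ⟨d, χ⟩ with hG
  set F : ℕ → ℝ := fun d => if D < d then G d else 0 with hF
  have hG0 : ∀ d, 0 ≤ G d := fun d => Finset.sum_nonneg fun _ _ => majorant_nonneg x _
  have hF0 : ∀ d, 0 ≤ F d := fun d => by
    simp only [hF]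
    split_ifs
    exacts [hG0 d, le_rfl]
  have h1 : ∀ q ∈ Icc 1 Q, ⨆ a : (ZMod q)ˣ,
      ‖((Nat.totient q : ℂ))⁻¹ *
          ∑ χ ∈ (Finset.univ : Finset (DirichletCharacter ℂ q)) with D < χ.conductor,
            χ (a : ZMod q)⁻¹ * chebyshevPsiChar χ x‖ ≤
      ((Nat.totient q : ℝ))⁻¹ * ∑ d ∈ q.divisors, F d +
        ⌊Real.log x / Real.log 2⌋₊ * ((Q : ℝ) * Real.log Q) * ((Nat.totient q : ℝ))⁻¹ := by
    intro q hq
    have hq1 : 1 ≤ q := (Finset.mem_Icc.1 hq).1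
    have hqQ : q ≤ Q := (Finset.mem_Icc.1 hq).2
    haveI : NeZero q := ⟨by omega⟩
    have hφ : 0 < (Nat.totient q : ℝ) := by exact_mod_cast Nat.totient_pos.2 hq1
    refine ciSup_le fun a => (norm_excised_le q a x hD).trans ?_
    have h2 := sum_highCond_le q hx D
    rw [Finset.sum_filter (fun d => D < d)] at h2
    calc (Nat.totient q : ℝ)⁻¹ *
          ∑ χ ∈ (Finset.univ : Finset (DirichletCharacter ℂ q)) with D < χ.conductor,
            ‖psiPrime χ x‖
        ≤ (Nat.totient q : ℝ)⁻¹ * (∑ d ∈ q.divisors, F d + q * nonCoprimePart q x) :=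
          mul_le_mul_of_nonneg_left h2 (inv_nonneg.2 hφ.le)
      _ = (Nat.totient q : ℝ)⁻¹ * ∑ d ∈ q.divisors, F d +
            (q : ℝ) / Nat.totient q * nonCoprimePart q x := by ring
      _ ≤ _ := by
          gcongr ?_ + ?_
          · exact le_rfl
          calc (q : ℝ) / Nat.totient q * nonCoprimePart q x
              ≤ (q : ℝ) / Nat.totient q * (⌊Real.log x / Real.log 2⌋₊ * Real.log q) :=
                mul_le_mul_of_nonneg_left (nonCoprimePart_le (by omega) hx) (by positivity)
            _ ≤ (Q : ℝ) / Nat.totient q * (⌊Real.log x / Real.log 2⌋₊ * Real.log Q) := by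
                gcongr
            _ = _ := by ring
  refine (Finset.sum_le_sum h1).trans ?_
  rw [Finset.sum_add_distrib, ← Finset.mul_sum, sum_mul_sum_divisors_eq Q]
  refine add_le_add ?_ (le_of_eq ?_)
  · calc ∑ d ∈ Icc 1 Q, F d * ∑ q ∈ Icc 1 Q with d ∣ q, ((Nat.totient q : ℝ))⁻¹
        ≤ ∑ d ∈ Icc 1 Q, F d * (((Nat.totient d : ℝ))⁻¹ * totientInvSum Q) :=
          Finset.sum_le_sum fun d hd => mul_le_mul_of_nonneg_left
            (sum_filter_dvd_totient_inv_le Q (Finset.mem_Icc.1 hd).1) (hF0 d)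
      _ = totientInvSum Q * ∑ d ∈ Icc 1 Q, if D < d then primTerm x d else 0 := by
          rw [Finset.mul_sum]
          refine Finset.sum_congr rfl fun d _ => ?_
          simp only [hF, hG, primTerm]
          split_ifs <;> ring
      _ ≤ totientInvSum Q * ∑ d ∈ Ioc D Q, primTerm x d := by
          rw [← Finset.sum_filter]
          refine mul_le_mul_of_nonneg_left (Finset.sum_le_sum_of_subset_of_nonneg (fun d hd => ?_)
            fun d _ _ => primTerm_nonneg x d) (totientInvSum_nonneg Q)
          rw [Finset.mem_filter, Finset.mem_Icc] at hd
          exact Finset.mem_Ioc.2 ⟨hd.2, hd.1.2⟩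
  · rw [totientInvSum]; ring

/-- **The high-conductor reduction with Vaughan's mean value theorem inserted** (the tree's
Abel-summed form `sum_Ioc_primTerm_le` of `VaughanBound C₁`): for `x ≥ 2`, `Q ≥ 1`, `D ≥ 1`,
`∑_{q ≤ Q} max_a ‖Δ♯_D(x; q, a)‖ ≤ W(Q) · C₁ log⁴(xQ) [x/(Q+1) + x^{5/6} + x^{1/2}Q
  + (x/(D+1) + x^{5/6}(1 + log Q) + x^{1/2}Q)] + ⌊log x/log 2⌋ Q log Q W(Q)`.
Unconditional through `vaughanBound_of_vaughan_meanValue vaughan_meanValue_holds`.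
[cite: Vaughan1980, Theorem 1] -/
theorem sum_excised_le_vaughan {C₁ : ℝ} (hC₁ : 0 ≤ C₁)
    (hV : Literature.NumberTheory.Sieve.VaughanBound C₁) {x : ℝ} (hx : 2 ≤ x) {Q D : ℕ}
    (hQ : 1 ≤ Q) (hD : 1 ≤ D) :
    ∑ q ∈ Finset.Icc 1 Q, ⨆ a : (ZMod q)ˣ,
        ‖((Nat.totient q : ℂ))⁻¹ *
            ∑ χ ∈ (Finset.univ : Finset (DirichletCharacter ℂ q)) with D < χ.conductor,
              χ (a : ZMod q)⁻¹ * Literature.NumberTheory.Sieve.chebyshevPsiChar χ x‖ ≤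
      Literature.NumberTheory.Sieve.totientInvSum Q *
          (C₁ * Real.log (x * Q) ^ 4 *
            (x / (Q + 1) + x ^ (5 / 6 : ℝ) + x ^ (1 / 2 : ℝ) * Q +
              (x / (D + 1) + x ^ (5 / 6 : ℝ) * (1 + Real.log Q) + x ^ (1 / 2 : ℝ) * Q))) +
        ⌊Real.log x / Real.log 2⌋₊ *
          ((Q : ℝ) * Real.log Q * Literature.NumberTheory.Sieve.totientInvSum Q) := by
  refine (sum_excised_le Q D hD x (by linarith)).trans ?_
  gcongr
  · exact totientInvSum_nonneg Q
  · exact sum_Ioc_primTerm_le hC₁ hV hx hQ hD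

/-- The same bound with the tree's PROVED Vaughan mean value theorem supplied: there is an absolute
`C₁ ≥ 0` such that for all `x ≥ 2`, `Q ≥ 1`, `D ≥ 1` the displayed inequality holds.
[cite: Vaughan1980, Theorem 1] -/
theorem exists_sum_excised_le :
    ∃ C₁ : ℝ, 0 ≤ C₁ ∧ ∀ x : ℝ, 2 ≤ x → ∀ Q D : ℕ, 1 ≤ Q → 1 ≤ D →
      ∑ q ∈ Finset.Icc 1 Q, ⨆ a : (ZMod q)ˣ,
          ‖((Nat.totient q : ℂ))⁻¹ *
              ∑ χ ∈ (Finset.univ : Finset (DirichletCharacter ℂ q)) with D < χ.conductor,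
                χ (a : ZMod q)⁻¹ * Literature.NumberTheory.Sieve.chebyshevPsiChar χ x‖ ≤
        Literature.NumberTheory.Sieve.totientInvSum Q *
            (C₁ * Real.log (x * Q) ^ 4 *
              (x / (Q + 1) + x ^ (5 / 6 : ℝ) + x ^ (1 / 2 : ℝ) * Q +
                (x / (D + 1) + x ^ (5 / 6 : ℝ) * (1 + Real.log Q) + x ^ (1 / 2 : ℝ) * Q))) +
          ⌊Real.log x / Real.log 2⌋₊ *
            ((Q : ℝ) * Real.log Q * Literature.NumberTheory.Sieve.totientInvSum Q) := by
  obtain ⟨C₁, hC₁, hV⟩ := vaughanBound_of_vaughan_meanValue vaughan_meanValue_holds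
  exact ⟨C₁, hC₁, fun x hx Q D hQ hD => sum_excised_le_vaughan hC₁ hV hx hQ hD⟩

end Summit.Parity.GeneralizedHardyLittlewood.Theorems.EH.HighConductorReduction
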